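import Summits.QuantumFields.YangMills.Theorems.LuscherReductionOneSiteLevelsPhaseDefs
import Literature.Analysis.OperatorTheory.YangMillsMatrixModelEigenfunctions

/-!
# INNER, layer vocabulary: the jump-Dirichlet currency on `SU(2)³` and the flat Kac form on `ℝ⁹` — definitions

Support module of crux `OneSiteLevels` (route `LuscherReduction`, item stmt-QuantumFields-20007; registered stub
`stub_absUpperInnerAL1 : (∀ k, LuscherHamiltonianEigenfunctions k) → ∀ k, OneSiteAbsUpperInner k`), fleet seat
ym-luscher-20007-p2 (LATTICE lane).  DEFINITIONS ONLY, nothing asserted: the shared vocabulary of the adopted plan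
(STUB-PLAN `Cruxes/OneSiteLevels/STUB-PLAN-stub_absUpperInnerAL1.md` §2.2, owner ruling INNER-RULING-g16) over which the two
layer statements are typed — so that both lanes and the skeleton (v12) import the SAME constants:

  `(∀ k, AL1 k) ⟹ ∀ k, FlatKacFormBound k`      (layer III, FLAT lane: Plancherel + min–max from the eigenfunctions)
  `FlatKacFormBound k ⟹ JumpEnergyLowerInner k`   (layer II, LATTICE lane: monotone gnomonic flattening)
  `JumpEnergyLowerInner k ⟹ OneSiteAbsUpperInner k` (layer I, LATTICE lane: jump-Dirichlet reduction, exact).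

## Contents
* §1 (lattice side, `Cfg = SU(2)³`, a-priori measure `cfgMeasure`).  `magWeight B f = e^{−(B/2)S}·f` (the transfer kernel is
  `K_B(U,V) = E_B(U,V) e^{−(B/2)(S(U)+S(V))}`, `transferKernel_eq_linkE_mul`, with `E_B = linkE B` symmetric of constant row sums
  `linkCE B`); the normalised jump form `latticeJump B g = ½∫∫ E_B (g(U) − g(V))² / linkCE B`; and `JumpEnergyLowerInner k`, the
  INNER statement in jump currency: `(E_k λ_b − C₁ λ_b²) ∫ g² ≤ latticeJump B g + ∫ B·S·g²` for `g = magWeight B (cos Θ_B · ψ)`, every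
  physical `ψ ⊥` `k` physical constraints, `E_k = physLevel (k+1)`, `λ_b = bareLambda B`.  By the jump identity
  `linkCE ∫g² − ⟨g, E_B g⟩ = ½∫∫E_B(g(U)−g(V))²` [LiebYau1988, (2.9)–(2.11)] and `1 + w ≤ e^w` this implies `OneSiteAbsUpperInner k`
  (layer I, companion proof file `…KacJump.lean`).
* §2 (flat side, `ZM = ℝ⁹`, Lebesgue).  The heat kernel `heatKernel t x y = (2πt)^{−9/2} e^{−‖x−y‖²/(2t)}` of `e^{−tH₀}`, `H₀ = −½Δ`;
  the Gaussian smoothing `heatSmooth`; the flat jump form `flatJump t g = (2t)⁻¹∫∫ p_t (g(x)−g(y))²` (`= t⁻¹⟨g, (1 − e^{−tH₀})g⟩`) and its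
  bilinear companion; the KAC FORM `kacForm t g = flatJump t g + ∫ V g²` (potential UNSATURATED, `V = luscherPotential`) and
  `kacBil`; `IsEigenFamily m f` (= the body of the named fact AL1 `LuscherHamiltonianEigenfunctions m`); and `FlatKacFormBound k`:
  for every `κ > 0` there are `C, t₀ > 0` and `k` flat constraint functions such that every bounded measurable colour-invariant `g`
  supported in the ball `‖x‖ ≤ κ/√t` and `L²`-orthogonal to the constraints has `kacForm t g ≥ (E_k − C t)‖g‖²` for `0 < t ≤ t₀`.

## Why these shapes (for the auditor)
* Jump currency, not form currency: a LOWER bound on a jump form is MONOTONE in the kernel, so the lattice kernel can be compared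
  chart-by-chart with the flat heat kernel by pointwise MINORANTS (`E_B ≥ e^{6B}e^{−Bμ²‖y−y′‖²}` on same-pattern pairs); the
  constants combine to exactly `1` at `μ = λ_b/2`, `B = 2/λ_b³` (`Bμ² = 1/(2λ_b)`, `8Bμ⁴ = λ_b`).
* Quantifier order `∀ κ ∃ C t₀ ∃ fs ∀ t` in `FlatKacFormBound`: the constraints do not depend on `t` (they are eigenfunctions), the
  lattice constraints built from them may depend on `B`; `C = C(k, κ)` is allowed by ONE's `∀ k ∃ C`.
* The sign of `E_k λ_b − C₁ λ_b²` is not controlled: both layer statements are kept MULTIPLICATIVE (never divide by it).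

## WHAT THIS IS NOT
No theorem of the crux is claimed here; the three layer implications are the companion proof files.  Femto rung R2b1 only;
AL1-conditional closure lives in the skeleton; nothing here is an infinite-volume ∕ Clay mass-gap statement.
References: E. H. Lieb, H.-T. Yau, Comm. Math. Phys. 118 (1988) (2.9)–(2.11); M. Lüscher, Nucl. Phys. B219 (1983) §2–§3;
B. Simon, Ann. Phys. 146 (1983) §3; M. Reed, B. Simon IV (1978) Thm. XIII.1–2.
-/

set_option autoImplicit false

noncomputable section

open MeasureTheory Filter Topology Real
open Literature.MathematicalPhysics.QuantumFieldTheory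
open Literature.MathematicalPhysics.QuantumLattice
open Literature.Analysis.OperatorTheory.YMMatrixModel

namespace Summit.QuantumFields.YangMills.Theorems.FemtoTransferGap

/-! ### §1. Lattice side: the jump-Dirichlet currency -/

/-- The one-site a-priori measure: product Haar on `SU(2)³` (`configMeasure SU2 1`, a probability measure). [folklore] -/
abbrev cfgMeasure : Measure Cfg := configMeasure Theorems.FemtoTransferGap.SU2 1

/-- **Magnetic half-weight** `magWeight B f = e^{−(B/2) S} · f` (`S = wilsonAction su2Rep`): since
`K_B(U,V) = E_B(U,V) e^{−(B/2)(S(U)+S(V))}`, the transfer form of `f` is the `E_B`-form of `magWeight B f`. [cite: Luscher1983, §3] -/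
def magWeight (B : ℝ) (f : Cfg → ℝ) (U : Cfg) : ℝ := Real.exp (-(B / 2) * wilsonAction su2Rep U) * f U

/-- `magWeight` unfolded. [folklore] -/
theorem magWeight_apply (B : ℝ) (f : Cfg → ℝ) (U : Cfg) :
    magWeight B f U = Real.exp (-(B / 2) * wilsonAction su2Rep U) * f U := rfl

/-- **Normalised jump form of the electric kernel**: `latticeJump B g = ½ ∫∫ E_B(U,V) (g(U) − g(V))² dU dV / linkCE B`
(`E_B = linkE B` is symmetric with constant row integrals `linkCE B`, so `⟨g, E_B g⟩ = linkCE B · (∫ g² − latticeJump B g)` by the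
jump-Dirichlet identity). [cite: LiebYau1988, (2.9)–(2.11)] -/
def latticeJump (B : ℝ) (g : Cfg → ℝ) : ℝ :=
  (1 / 2 : ℝ) * (∫ U, ∫ V, linkE B U V * (g U - g V) ^ 2 ∂cfgMeasure ∂cfgMeasure) / linkCE B

/-- **INNER in jump currency** (`JumpEnergyLowerInner k`, layer-II output ∕ layer-I input): there are `C₁` and `B₁ ≥ 2` such that for
`B ≥ B₁` some `k` physical constraints `φ_i` force, for every physical `ψ ⊥ φ_i` and `g = magWeight B (cos Θ_B · ψ)`
(`Θ_B = onePhase (onePhaseScale B)`),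
`(E_k λ_b − C₁ λ_b²) ∫ g² ≤ latticeJump B g + ∫ B · S · g²`, `E_k = physLevel (k+1)`, `λ_b = bareLambda B`.
(Multiplicative form on purpose: the coefficient may be negative.) [cite: Luscher1983, §3] [cite: SimonB1983DiscreteSpectrum, §3] -/
def JumpEnergyLowerInner (k : ℕ) : Prop :=
  ∃ C₁ B₁ : ℝ, 2 ≤ B₁ ∧ ∀ B, B₁ ≤ B → ∃ φs : Fin k → Cfg → ℝ, (∀ i, IsPhys (φs i)) ∧
    ∀ ψ : Cfg → ℝ, IsPhys ψ → (∀ i, l2 ψ (φs i) = 0) →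
      (physLevel (k + 1) * bareLambda B - C₁ * bareLambda B ^ 2) *
          ∫ U, magWeight B (fun U => Real.cos (onePhase (onePhaseScale B) U) * ψ U) U ^ 2 ∂cfgMeasure ≤
        latticeJump B (magWeight B (fun U => Real.cos (onePhase (onePhaseScale B) U) * ψ U)) +
          ∫ U, B * wilsonAction su2Rep U *
            magWeight B (fun U => Real.cos (onePhase (onePhaseScale B) U) * ψ U) U ^ 2 ∂cfgMeasure

/-! ### §2. Flat side: the heat kernel and the Kac form on `ℝ⁹` -/

/-- **Heat kernel** of `e^{−tH₀}`, `H₀ = −½Δ` on `ZM = ℝ⁹`: `p_t(x,y) = (2πt)^{−9/2} e^{−‖x−y‖²/(2t)}` (the Gaussian of covariance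
`t·Id`). [cite: ReedSimonIV1978, Thm. XIII.1–2] -/
def heatKernel (t : ℝ) (x y : ZM) : ℝ := (2 * π * t) ^ (-(9 : ℝ) / 2) * Real.exp (-‖x - y‖ ^ 2 / (2 * t))

/-- **Gaussian smoothing** `heatSmooth t g = P_t g = e^{−tH₀} g`, `(P_t g)(x) = ∫ p_t(x,y) g(y) dy`. [cite: ReedSimonIV1978, Thm. XIII.1–2] -/
def heatSmooth (t : ℝ) (g : ZM → ℝ) (x : ZM) : ℝ := ∫ y, heatKernel t x y * g y

/-- **Flat jump form** `flatJump t g = (2t)⁻¹ ∫∫ p_t(x,y) (g(x) − g(y))² dx dy` (`= t⁻¹⟨g, (1 − P_t) g⟩` for `g ∈ L²`; MONOTONE in the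
kernel). [cite: LiebYau1988, (2.9)–(2.11)] -/
def flatJump (t : ℝ) (g : ZM → ℝ) : ℝ := 1 / (2 * t) * ∫ x, ∫ y, heatKernel t x y * (g x - g y) ^ 2

/-- The bilinear companion of `flatJump`: `(2t)⁻¹ ∫∫ p_t(x,y) (u(x) − u(y))(v(x) − v(y))`. [cite: LiebYau1988, (2.9)–(2.11)] -/
def flatJumpBil (t : ℝ) (u v : ZM → ℝ) : ℝ := 1 / (2 * t) * ∫ x, ∫ y, heatKernel t x y * ((u x - u y) * (v x - v y))

/-- **The Kac form** at heat time `t`: `kacForm t g = flatJump t g + ∫ V g²`, `V = luscherPotential` (potential UNSATURATED); the quadratic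
form behind `t⁻¹(1 − e^{−tV/2} e^{−tH₀} e^{−tV/2})` to the accuracy `O(t)` used by the crux. [cite: SimonB1983DiscreteSpectrum, §3] -/
def kacForm (t : ℝ) (g : ZM → ℝ) : ℝ := flatJump t g + ∫ x, luscherPotential x * g x ^ 2

/-- The bilinear companion of `kacForm`. [cite: SimonB1983DiscreteSpectrum, §3] -/
def kacBil (t : ℝ) (u v : ZM → ℝ) : ℝ := flatJumpBil t u v + ∫ x, luscherPotential x * (u x * v x)

/-- `IsEigenFamily m f`: the BODY of the named fact AL1 `LuscherHamiltonianEigenfunctions m` as a predicate on the family `f_0, …, f_m`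
(smooth, colour-invariant, `L²`-orthonormal classical eigenfunctions of `𝔥 = −½Δ + V` for the levels `physLevel 1 … physLevel (m+1)`,
with `ExpDecay₂`), so that `LuscherHamiltonianEigenfunctions m ↔ ∃ f, IsEigenFamily m f` definitionally.
[cite: ReedSimonIV1978, Thm. XIII.64] [cite: Agmon1982, Cor. 4.5, Thm. 5.1] -/
def IsEigenFamily (m : ℕ) (f : Fin (m + 1) → ZM → ℝ) : Prop :=
  (∀ j, ∀ n : ℕ∞, ContDiff ℝ n (f j)) ∧ (∀ j, IsGaugeInv (f j)) ∧
    (∀ i j, ∫ x, f i x * f j x = if i = j then (1 : ℝ) else 0) ∧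
    (∀ j, ∀ x : ZM, hApply (f j) x = physLevel ((j : ℕ) + 1) * f j x) ∧ (∀ j, ExpDecay₂ (f j))

/-- AL1 at index `m` is literally `∃ f, IsEigenFamily m f`. [cite: ReedSimonIV1978, Thm. XIII.64] -/
theorem isEigenFamily_of_AL1 (m : ℕ) (h : LuscherHamiltonianEigenfunctions m) : ∃ f, IsEigenFamily m f := h

/-- **The flat Kac-form bound on the inner ball** (`FlatKacFormBound k`, layer-III output ∕ layer-II input): for every `κ > 0` there are
`C`, `t₀ > 0` and `k` flat constraint functions `fs_i` (continuous, bounded, colour-invariant, integrable — intended: the first `k`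
eigenfunctions of `𝔥`) such that for `0 < t ≤ t₀` every measurable bounded colour-invariant `g` supported in `‖x‖ ≤ κ/√t` with
`∫ g · fs_i = 0` satisfies `(E_k − C t) ∫ g² ≤ kacForm t g`, `E_k = physLevel (k+1)`.  (The `O(t)` deficit is sharp: `½‖H₀ f_k‖²·t` is
attained on the span.) [cite: SimonB1983DiscreteSpectrum, §3] [cite: ReedSimonIV1978, Thm. XIII.1–2] -/
def FlatKacFormBound (k : ℕ) : Prop :=
  ∀ κ : ℝ, 0 < κ → ∃ C t₀ : ℝ, 0 < t₀ ∧ ∃ fs : Fin k → ZM → ℝ,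
    (∀ i, Continuous (fs i)) ∧ (∀ i, ∃ M : ℝ, ∀ x, |fs i x| ≤ M) ∧ (∀ i, IsGaugeInv (fs i)) ∧ (∀ i, Integrable (fs i)) ∧
    ∀ t : ℝ, 0 < t → t ≤ t₀ → ∀ g : ZM → ℝ, Measurable g → (∃ M : ℝ, ∀ x, |g x| ≤ M) → IsGaugeInv g →
      (∀ x, g x ≠ 0 → ‖x‖ ≤ κ / Real.sqrt t) → (∀ i, ∫ x, g x * fs i x = 0) →
      (physLevel (k + 1) - C * t) * ∫ x, g x ^ 2 ≤ kacForm t g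

end Summit.QuantumFields.YangMills.Theorems.FemtoTransferGap

end
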